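import Summits.BirchSwinnertonDyer.BirchSwinnertonDyer.Theorems.QuadraticBranchSignedControlPlusEtaNonsurjFineRoadConjA
import Literature.NumberTheory.EllipticCurves.FineSelmerCongruentCurves
import HarnessLib

/-!
# Route `QuadraticBranchSignedControl` (rung K8, cell `bsd-potss`), residual crux
# `PlusEtaMainConjectureNonsurj` (stmt-BirchSwinnertonDyer-19606): the FINE ROAD, part 3 — the CONGRUENT
# (A)-ANCHOR road (Lim–Sujatha 2018 Prop. 3.2, PROVED in the tree) and the stub-shaped ∀-forms (seat k8eta-c2 g6)

WHAT. Parts 1–2 (`…PlusEtaNonsurjFineRoad`, `…FineRoadConjA`): on every row of crux 19606 the `μ`-statement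
`μ(X⁺(V/K_∞)^η) = 0` follows from statement (A) of Coates–Sujatha for the ADDITIVE partner `W = V^{(p*)}` and
the analytic `μ(L_p⁺(V,η,X)) = 0`, modulo Kobayashi's Thm. 6.2/6.3/7.3 i)/Cor. 7.2 at `η` (`h6273`). THIS FILE:
* §5 the ∀-forms on the skeleton's binders (rank-`0` non-CM + L₀; rank-`0` CM; prime-`L` rank-`1` — there
  (C1⁺_η) ⟸ (A)(W,p) ALONE), for the planner;
* §6 **the congruent (A)-anchor road**: (A) is a mod-`p` CONGRUENCE INVARIANT — Lim–Sujatha 2018 Prop. 3.2,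
  whose tree transcription `LimSujatha2018.prop32_fineSelmerDual_moduleFinite_iff_of_torsionIso` is PROVED
  (`…_holds`, seat conjA-anchor g5) — so (A)(W′,p) for ANY curve `W′` with `W[p] ≅ W′[p]` (displayed: the
  unfolded body of `O6.ModPCongruent W W′ p`, per row a Kraus–Oesterlé certificate) gives (A)(W,p)
  (`conjA_of_torsionIso_of_conjA`), hence the `μ`-statement at `V` (`eta_hasUnitContent_of_congruent_conjA_of_analyticMu`),
  hence (C1⁺_η)(V) on a rank-`0` row whose analytic `#Ш(W)` is a `p`-adic unit (L₀ then trivial: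
  `…_of_congruent_conjA_of_shaAn_unit`, ctrl g4's road) and on a prime-`L` rank-`1` row
  (`…_of_span_eq_span_X_of_congruent_conjA`). Compared with g3/g5's Hatley–Lei anchor road
  (`etaUpperIntegral_of_modPCongruent_unitRow`, which needs a UNIT-ROW anchor and the cite-only Thm. 4.6),
  the anchor here may be ANY curve with (A) — e.g. a rank-`1` CM curve certified by Deo–Ray–Sujatha 2023
  Thm. 3.7 (`H²(ℚ_S/ℚ, W′[p]) = 0`; census kit j277504: the CM anchors 675a1, 2700p1, 14400l1, 11025b1 of the
  non-CM classes pass) — and the transfer theorem is PROVED, not cited.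

HONEST FRAMING (cell `bsd-potss`; FULL-BSD rank ≤ 1 programme, HUMAN RULING D-0036/D-0074): BOOKKEEPING
THEOREMS ONLY — no definition, no named fact minted, no `sorry`, axioms standard. CONDITIONAL on the
displayed named facts (`h6273`, `h22`, `h41`, `hPT`, `hmod`, `hGZK`, `hKO`, `hS28`) and DISPLAYED per-row
inputs ((A) at the anchor, the torsion isomorphism, the analytic `μ`, the analytic `#Ш`, `(L_p⁺) = (X)`). No
stub of 19606 is proved by name; the crux stays OPEN; nothing is booked; `BSD(W,p)` is claimed for no pair.
`--supports stmt-BirchSwinnertonDyer-19606`.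

References: [LimSujatha2018] §3 Prop. 3.2; [DeoRaySujatha2023] Thm. 3.7–3.9; [CoatesSujatha2005] §3 (A);
[Kobayashi2003] Thm. 7.3 i) (7.21), §4 + Thm. 4.1 (p. 8); [KrausOesterle1992] Prop. 4; [Miller2011LMS] Def. 1.1.
-/

set_option autoImplicit false
set_option linter.dupNamespace false

noncomputable section

open scoped Classical

open CongruenceSubgroup Field Function NumberField IsDedekindDomain WeierstrassCurve
open Literature.NumberTheory.EllipticCurves
open Literature.NumberTheory.EllipticCurves.ModularForms
open Literature.NumberTheory.EllipticCurves.Rank1Residual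
open Literature.NumberTheory.EllipticCurves.Rank1Residual.Typed
open Literature.NumberTheory.GaloisRepresentations
open Literature.NumberTheory.GaloisCohomology
open Literature.NumberTheory.EllipticCurves.IwasawaAlgebra
open Literature.NumberTheory.EllipticCurves.IwasawaDual ZpExtension
open Literature.NumberTheory.EllipticCurves.GreenbergVatsal2000
open Summit.BirchSwinnertonDyer.Rank1Residual.X11b.Levels
open Summit.BirchSwinnertonDyer.Rank1Residual.X11b
open Summit.BirchSwinnertonDyer.Rank1Residual.Additive
open Summit.BirchSwinnertonDyer.Rank1Residual.Additive.SignedTwist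
open scoped ContRepresentation
open Summit.BirchSwinnertonDyer.Rank1Residual.AdditivePotMult

namespace Summit.BirchSwinnertonDyer.BirchSwinnertonDyer.Theorems

namespace EtaFineRoad

/-! ## §5 The stub-shaped ∀-forms on 19606's binders (for the planner) -/

/-- **19606 on its NON-CM rank-`0` rows ⟸ (A) on the partners + analytic `μ` + L₀** (the binders of
`stub_etaMC_r0_mu` / `stub_etaMC_r0_lowerBSD` of skeleton v4: `p ≥ 5`, `C • W^{(p*)} = V`, good, `a_p = 0`,
tower NOT onto — idle —, `L(W,1) ≠ 0`): the `μ`-stub REPLACED by «(A)(W,p) ∧ `μ(L_p⁺(V,η,X)) = 0`».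
CONDITIONAL on `hPT`, `hmod`, `hGZK`, `h22`, `h41`, `hKO`, `h6273`; no stub proved by name; nothing booked.
[cite: Kobayashi2003, §4 and Thm. 4.1 (p. 8), Thm. 7.3 i) (p. 13)] [cite: CoatesSujatha2005, §3 statement (A)]
[cite: Miller2011LMS, Def. 1.1] -/
theorem etaMC_rankZeroRows_of_conjA_of_analyticMu_of_lowerBSD
    (hPT : poitouTate_selmerStructure_duality_real ℚ) (hmod : hasEntireLFunction_rat)
    (hGZK : rank_eq_analyticRank_of_analyticRank_le_one)
    (h22 : Kobayashi2003.thm22_etaSignedSelmerDual_finite_torsion)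
    (h41 : Kobayashi2003.thm41_plusEtaCharIdeal_dvd)
    (hKO : KitajimaOtsuki2018.mainThm13_etaSignedSelmerDual_noFiniteSubmodule)
    (h6273 : Kobayashi2003.thm62_63_73_etaColemanPoitouTate) :
    ∀ (V : WeierstrassCurve ℚ) [V.IsElliptic] [V.IsGloballyMinimal] (W : WeierstrassCurve ℚ) [W.IsElliptic]
      [W.IsGloballyMinimal] (C : VariableChange ℚ) (p : ℕ) [Fact p.Prime],
      5 ≤ p → C • W.quadraticTwist ((-1) ^ (p / 2) * p) = V →
      V.HasGoodReductionAtPrime p → V.frobeniusTrace p = 0 →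
      ¬ (∀ m : ℕ, V.HasSurjectiveModNGaloisRep (p ^ m : ℕ)) → W.entireLFunction 1 ≠ 0 →
      (∀ (κ : ZpExtension ℚ p), κ.IsCyclotomic →
        ∃ (γ : absoluteGaloisGroup ℚ) (D : W.FineSelmerDualData κ γ),
          Module.Finite ℤ_[p] (RestrictScalars ℤ_[p] (IwasawaAlgebra p) D.X)) →
      (∀ {N : ℕ} [NeZero N] {f : CuspForm (Gamma0 N) 2}, IsNewformOf V f →
        ∀ (ϖ : ℚ), (if Even (p / 2) then (ϖ : ℝ) * V.realPeriodRat = plusPeriod f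
            else (ϖ : ℝ) * V.imaginaryPeriodRat = minusPeriod f) →
        ∀ (Lη : IwasawaAlgebra p), IsQuadraticBranchPlusLFunction f p ϖ Lη → HasUnitContent Lη) →
      MissingLowerBoundAt W p → QuadraticBranchPlusEtaMainConjectureAt V p := by
  intro V _ _ W _ _ C p _ hp5 hCV hgood hap _ hLW hA hμan hlow
  exact quadraticBranchPlusEtaMainConjectureAt_of_conjA_of_analyticMu_of_missingLowerBoundAt W p hPT hmod
    hGZK h22 h41 hKO h6273 V C hp5 hCV hgood hap hA hμan hLW hlow

/-- **19606 on its CM rank-`0` rows ⟸ (A) on the CM partners + analytic `μ`** (binders of `stub_etaMC_cm`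
restricted to rank `0`, with the partner displayed). CONDITIONAL on `hPT`, `hmod`, `hGZK`, `h22`, `h41`,
`hKO`, `hS28`, `h6273`; no stub proved by name; nothing booked. [cite: PollackRubin2004, Theorem and remark p. 448]
[cite: CoatesSujatha2005, §3 statement (A)] [cite: BurungaleFlach2024, Thm 1.1 and Cor. 2] -/
theorem etaMC_cm_rankZeroRows_of_conjA_of_analyticMu
    (hPT : poitouTate_selmerStructure_duality_real ℚ) (hmod : hasEntireLFunction_rat)
    (hGZK : rank_eq_analyticRank_of_analyticRank_le_one)
    (h22 : Kobayashi2003.thm22_etaSignedSelmerDual_finite_torsion)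
    (h41 : Kobayashi2003.thm41_plusEtaCharIdeal_dvd)
    (hKO : KitajimaOtsuki2018.mainThm13_etaSignedSelmerDual_noFiniteSubmodule)
    (hS28 : bsdTriple_of_hasCM_of_L_one_ne_zero)
    (h6273 : Kobayashi2003.thm62_63_73_etaColemanPoitouTate) :
    ∀ (V : WeierstrassCurve ℚ) [V.IsElliptic] [V.IsGloballyMinimal] (p : ℕ) [Fact p.Prime],
      5 ≤ p → V.HasGoodReductionAtPrime p → V.frobeniusTrace p = 0 →
      ¬ (∀ m : ℕ, V.HasSurjectiveModNGaloisRep (p ^ m : ℕ)) → V.HasCM →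
      ∀ (W : WeierstrassCurve ℚ) [W.IsElliptic] [W.IsGloballyMinimal] (C : VariableChange ℚ),
        C • W.quadraticTwist ((-1) ^ (p / 2) * p) = V → W.entireLFunction 1 ≠ 0 →
        (∀ (κ : ZpExtension ℚ p), κ.IsCyclotomic →
          ∃ (γ : absoluteGaloisGroup ℚ) (D : W.FineSelmerDualData κ γ),
            Module.Finite ℤ_[p] (RestrictScalars ℤ_[p] (IwasawaAlgebra p) D.X)) →
        (∀ {N : ℕ} [NeZero N] {f : CuspForm (Gamma0 N) 2}, IsNewformOf V f →
          ∀ (ϖ : ℚ), (if Even (p / 2) then (ϖ : ℝ) * V.realPeriodRat = plusPeriod f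
              else (ϖ : ℝ) * V.imaginaryPeriodRat = minusPeriod f) →
          ∀ (Lη : IwasawaAlgebra p), IsQuadraticBranchPlusLFunction f p ϖ Lη → HasUnitContent Lη) →
        QuadraticBranchPlusEtaMainConjectureAt V p := by
  intro V _ _ p _ hp5 hgood hap _ hCM W _ _ C hCV hLW hA hμan
  exact quadraticBranchPlusEtaMainConjectureAt_of_conjA_of_analyticMu_of_hasCM_rankZero W p hPT hmod hGZK
    h22 h41 hKO hS28 h6273 V C hp5 hCV hgood hap hCM hA hμan hLW

/-- **19606 on its prime-`L` rank-`1` rows ⟸ (A) on the partners ALONE** (the binders of `stub_etaMC_r1_mu`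
of skeleton v4: `p ≥ 5`, `C • W^{(p*)} = V`, good, `a_p = 0`, tower NOT onto — idle —, `r_an(W) = 1`,
`(L_p⁺(V,η,X)) = (X)` displayed): `stub_etaMC_r1_mu`'s conclusion `EtaMuZeroAt V p` is not produced verbatim
(the frame carries the cyclotomic-variable normalisation of `γ`), but its only USE — the composition
`etaMC_r1_of_mu` — is: (C1⁺_η)(V,p) outright. CONDITIONAL on `h22`, `h41`, `hGZK`, `h6273`; no stub proved
by name; nothing booked. [cite: Kobayashi2003, §4 Even main conjecture and Thm. 4.1 first display (p. 8), Thm. 7.3 i) (p. 13)]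
[cite: CoatesSujatha2005, §3 statement (A)] [cite: GreenbergLNM1716, §4 Lemma 4.2 (p. 102)] -/
theorem etaMC_rankOneRows_of_conjA_of_span_eq_span_X
    (h22 : Kobayashi2003.thm22_etaSignedSelmerDual_finite_torsion)
    (h41 : Kobayashi2003.thm41_plusEtaCharIdeal_dvd)
    (hGZK : rank_eq_analyticRank_of_analyticRank_le_one)
    (h6273 : Kobayashi2003.thm62_63_73_etaColemanPoitouTate) :
    ∀ (V : WeierstrassCurve ℚ) [V.IsElliptic] [V.IsGloballyMinimal] (W : WeierstrassCurve ℚ) [W.IsElliptic]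
      [W.IsGloballyMinimal] (C : VariableChange ℚ) (p : ℕ) [Fact p.Prime],
      5 ≤ p → C • W.quadraticTwist ((-1) ^ (p / 2) * p) = V →
      V.HasGoodReductionAtPrime p → V.frobeniusTrace p = 0 →
      ¬ (∀ m : ℕ, V.HasSurjectiveModNGaloisRep (p ^ m : ℕ)) → W.analyticRank = 1 →
      (∀ {N : ℕ} [NeZero N] {f : CuspForm (Gamma0 N) 2}, IsNewformOf V f →
        ∀ (ϖ : ℚ), (if Even (p / 2) then (ϖ : ℝ) * V.realPeriodRat = plusPeriod f
            else (ϖ : ℝ) * V.imaginaryPeriodRat = minusPeriod f) →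
        ∀ (Lη : IwasawaAlgebra p), IsQuadraticBranchPlusLFunction f p ϖ Lη →
          Ideal.span {Lη} = Ideal.span {(PowerSeries.X : IwasawaAlgebra p)}) →
      (∀ (κ : ZpExtension ℚ p), κ.IsCyclotomic →
        ∃ (γ : absoluteGaloisGroup ℚ) (D : W.FineSelmerDualData κ γ),
          Module.Finite ℤ_[p] (RestrictScalars ℤ_[p] (IwasawaAlgebra p) D.X)) →
      QuadraticBranchPlusEtaMainConjectureAt V p := by
  intro V _ _ W _ _ C p _ hp5 hCV hgood hap _ h1 hX hA
  exact quadraticBranchPlusEtaMainConjectureAt_of_span_eq_span_X_of_conjA W p h22 h41 h6273 V C hp5 hCV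
    hgood hap (EtaPrimeRoad.not_finite_selmer_of_analyticRank_eq_one W (p := p) hGZK h1) hX hA

/-! ## §6 The congruent (A)-anchor road (Lim–Sujatha Prop. 3.2, PROVED) -/

section Anchor

variable (W : WeierstrassCurve ℚ) [W.IsElliptic] [W.IsGloballyMinimal] (p : ℕ) [hp : Fact p.Prime]

omit [W.IsGloballyMinimal] in
/-- **(A) transfers along a mod-`p` congruence (Lim–Sujatha 2018 Prop. 3.2, PROVED in the tree).** For `p`
odd and curves `W`, `W′` over `ℚ` with a `Γ_ℚ`-equivariant `W[p] ≃ W′[p]` (the body of `O6.ModPCongruent W W′ p`,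
`Iff.rfl`): (A)(W′,p) ⟹ (A)(W,p), both in the cell's `∃ γ D` currency. A one-line use of
`LimSujatha2018.prop32_fineSelmerDual_moduleFinite_iff_of_torsionIso_holds`. [cite: LimSujatha2018, §3 Prop. 3.2] -/
theorem conjA_of_torsionIso_of_conjA (hp2 : p ≠ 2) (W' : WeierstrassCurve ℚ) [W'.IsElliptic]
    (hcong : ∃ e : W.geomTorsion (p : ℤ) ≃+ W'.geomTorsion (p : ℤ),
      ∀ (σ : absoluteGaloisGroup ℚ) (P : W.geomTorsion (p : ℤ)), e (σ • P) = σ • e P)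
    (hA' : ∀ (κ : ZpExtension ℚ p), κ.IsCyclotomic →
      ∃ (γ : absoluteGaloisGroup ℚ) (D : W'.FineSelmerDualData κ γ),
        Module.Finite ℤ_[p] (RestrictScalars ℤ_[p] (IwasawaAlgebra p) D.X)) :
    ∀ (κ : ZpExtension ℚ p), κ.IsCyclotomic →
      ∃ (γ : absoluteGaloisGroup ℚ) (D : W.FineSelmerDualData κ γ),
        Module.Finite ℤ_[p] (RestrictScalars ℤ_[p] (IwasawaAlgebra p) D.X) :=
  fun κ hκ ↦ (LimSujatha2018.prop32_fineSelmerDual_moduleFinite_iff_of_torsionIso_holds W W' p hp2 hcong κ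
    hκ).mpr (hA' κ hκ)

omit [W.IsGloballyMinimal] in
/-- **The `μ`-statement at `V` from a congruent (A)-anchor and the analytic `μ`** (§3 ∘ §6): `W′` with
`W[p] ≅ W′[p]` and (A)(W′,p) (e.g. a Deo–Ray–Sujatha-certified CM curve of any rank), `μ(L_p⁺(V,η,X)) = 0`
`⟹` every characteristic generator of every datum of `Sel⁺(V/K_∞)^η` has unit content, on every `η`-frame.
No Hatley–Lei, no unit row. CONDITIONAL on `h6273`. [cite: LimSujatha2018, §3 Prop. 3.2]
[cite: Kobayashi2003, Thm. 7.3 i) (7.21) (p. 13)] [cite: CoatesSujatha2005, §3 statement (A)] -/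
theorem eta_hasUnitContent_of_congruent_conjA_of_analyticMu
    (h6273 : Kobayashi2003.thm62_63_73_etaColemanPoitouTate)
    (V : WeierstrassCurve ℚ) [V.IsElliptic] [V.IsGloballyMinimal] (C : VariableChange ℚ)
    (hCV : C • W.quadraticTwist ((-1) ^ (p / 2) * p) = V) (hp2 : p ≠ 2)
    (W' : WeierstrassCurve ℚ) [W'.IsElliptic]
    (hcong : ∃ e : W.geomTorsion (p : ℤ) ≃+ W'.geomTorsion (p : ℤ),
      ∀ (σ : absoluteGaloisGroup ℚ) (P : W.geomTorsion (p : ℤ)), e (σ • P) = σ • e P)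
    (hA' : ∀ (κ : ZpExtension ℚ p), κ.IsCyclotomic →
      ∃ (γ : absoluteGaloisGroup ℚ) (D : W'.FineSelmerDualData κ γ),
        Module.Finite ℤ_[p] (RestrictScalars ℤ_[p] (IwasawaAlgebra p) D.X))
    (hμan : ∀ {N : ℕ} [NeZero N] {f : CuspForm (Gamma0 N) 2}, IsNewformOf V f →
      ∀ (ϖ : ℚ), (if Even (p / 2) then (ϖ : ℝ) * V.realPeriodRat = plusPeriod f
          else (ϖ : ℝ) * V.imaginaryPeriodRat = minusPeriod f) →
      ∀ (Lη : IwasawaAlgebra p), IsQuadraticBranchPlusLFunction f p ϖ Lη → HasUnitContent Lη) :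
    ∀ (K₀ : Type) [Field K₀] [NumberField K₀] [IsCyclotomicExtension {p} ℚ K₀]
        [(galRange (K := ℚ) K₀).Normal] (ηq : absoluteGaloisGroup ℚ →* ℤˣ),
        (∀ σ ∈ galRange (K := ℚ) K₀, ηq σ = 1) → ηq ≠ 1 →
      ∀ {N : ℕ} [NeZero N] {f : CuspForm (Gamma0 N) 2},
        p ≠ 2 → V.HasGoodReductionAtPrime p → V.frobeniusTrace p = 0 → IsNewformOf V f →
      ∀ (ϖ : ℚ), (if Even (p / 2) then (ϖ : ℝ) * V.realPeriodRat = plusPeriod f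
          else (ϖ : ℝ) * V.imaginaryPeriodRat = minusPeriod f) →
      ∀ (κ : ZpExtension ℚ p) (γ : absoluteGaloisGroup ℚ),
        κ.IsCyclotomic → κ.IsTopGenerator γ → γ ∈ galRange (K := ℚ) K₀ → IsCyclotomicVariable p γ →
      ∀ (D : EtaSignedSelmerDualData V κ K₀ ℚ_[p] ηq γ 1) (g : IwasawaAlgebra p),
        D.charIdeal = Ideal.span {g} → HasUnitContent g :=
  eta_hasUnitContent_of_conjA_of_analyticMu W p h6273 V C hCV
    (conjA_of_torsionIso_of_conjA W p hp2 W' hcong hA') hμan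

/-- **Rank-`0` row with `p`-adic unit analytic `#Ш(W)` from a congruent (A)-anchor** (the IN-TABLE shape
of the 7 Tamagawa rows of skeleton v4: `#Ш(W)_an ∈ {1,4}`, anchors 2700p1 / 675a1 / 14400l1, CM of rank `1`,
Deo–Ray–Sujatha-certified in census j277504): `p ≥ 5`, `C • W^{(p*)} = V`, good, `a_p(V) = 0`, `L(W,1) ≠ 0`,
`#Ш(W)_an = q` with `ord_p q = 0` (analytic INPUT; L₀ is then the trivial inequality), `W[p] ≅ W′[p]`,
(A)(W′,p), `μ(L_p⁺(V,η,X)) = 0` `⟹` (C1⁺_η)(V). Through §3's integral upper inclusion and ctrl g4's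
`ConverseControl.quadraticBranchPlusEtaMainConjectureAt_of_etaUpperIntegral_of_missingLowerBoundAt`.
CONDITIONAL on `hPT`, `hmod`, `hGZK`, `h22`, `h41`, `hKO`, `h6273`; nothing booked.
[cite: Kobayashi2003, §4 and Thm. 4.1 (p. 8)] [cite: LimSujatha2018, §3 Prop. 3.2] [cite: Miller2011LMS, Def. 1.1] -/
theorem quadraticBranchPlusEtaMainConjectureAt_of_congruent_conjA_of_shaAn_unit
    (hPT : poitouTate_selmerStructure_duality_real ℚ) (hmod : hasEntireLFunction_rat)
    (hGZK : rank_eq_analyticRank_of_analyticRank_le_one)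
    (h22 : Kobayashi2003.thm22_etaSignedSelmerDual_finite_torsion)
    (h41 : Kobayashi2003.thm41_plusEtaCharIdeal_dvd)
    (hKO : KitajimaOtsuki2018.mainThm13_etaSignedSelmerDual_noFiniteSubmodule)
    (h6273 : Kobayashi2003.thm62_63_73_etaColemanPoitouTate)
    (V : WeierstrassCurve ℚ) [V.IsElliptic] [V.IsGloballyMinimal] (C : VariableChange ℚ)
    (hp5 : 5 ≤ p) (hCV : C • W.quadraticTwist ((-1) ^ (p / 2) * p) = V)
    (hgood : V.HasGoodReductionAtPrime p) (hap : V.frobeniusTrace p = 0)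
    (hLW : W.entireLFunction 1 ≠ 0) {q : ℚ} (hq : shaAn W = (q : ℂ)) (hv : padicValRat p q = 0)
    (W' : WeierstrassCurve ℚ) [W'.IsElliptic]
    (hcong : ∃ e : W.geomTorsion (p : ℤ) ≃+ W'.geomTorsion (p : ℤ),
      ∀ (σ : absoluteGaloisGroup ℚ) (P : W.geomTorsion (p : ℤ)), e (σ • P) = σ • e P)
    (hA' : ∀ (κ : ZpExtension ℚ p), κ.IsCyclotomic →
      ∃ (γ : absoluteGaloisGroup ℚ) (D : W'.FineSelmerDualData κ γ),
        Module.Finite ℤ_[p] (RestrictScalars ℤ_[p] (IwasawaAlgebra p) D.X))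
    (hμan : ∀ {N : ℕ} [NeZero N] {f : CuspForm (Gamma0 N) 2}, IsNewformOf V f →
      ∀ (ϖ : ℚ), (if Even (p / 2) then (ϖ : ℝ) * V.realPeriodRat = plusPeriod f
          else (ϖ : ℝ) * V.imaginaryPeriodRat = minusPeriod f) →
      ∀ (Lη : IwasawaAlgebra p), IsQuadraticBranchPlusLFunction f p ϖ Lη → HasUnitContent Lη) :
    QuadraticBranchPlusEtaMainConjectureAt V p :=
  have hp2 : p ≠ 2 := by omega
  ConverseControl.quadraticBranchPlusEtaMainConjectureAt_of_etaUpperIntegral_of_missingLowerBoundAt W p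
    hPT hmod hGZK h22 hKO V C hp5 hCV hgood hap
    (etaUpperIntegral_of_conjA_of_analyticMu W p h22 h41 h6273 V C hCV
      (conjA_of_torsionIso_of_conjA W p hp2 W' hcong hA') hμan)
    hLW ⟨q, hq, by rw [hv]; exact_mod_cast Nat.zero_le _⟩

omit [W.IsGloballyMinimal] in
/-- **Prime-`L` rank-`1` row from a congruent (A)-anchor ALONE** (the shape of the 16 non-CM rank-`1` rows
below `5·10⁵`: anchors 900b1, 3600bb1, 10800cj1, 14400cz1 (rank `0`), 2700p1, 675a1, 14400l1, 11025b1,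
11025e1, all Deo–Ray–Sujatha-certified in census j277504): `p ≥ 5`, `C • W^{(p*)} = V`, good, `a_p(V) = 0`,
`Sel_{p^∞}(W/ℚ)` infinite, `(L_p⁺(V,η,X)) = (X)`, `W[p] ≅ W′[p]`, (A)(W′,p) `⟹` (C1⁺_η)(V) — the analytic `μ`
being automatic. CONDITIONAL on `h22`, `h41`, `h6273`; nothing booked. [cite: Kobayashi2003, §4 and Thm. 4.1 first display (p. 8)]
[cite: LimSujatha2018, §3 Prop. 3.2] [cite: GreenbergLNM1716, §4 Lemma 4.2 (p. 102)] -/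
theorem quadraticBranchPlusEtaMainConjectureAt_of_span_eq_span_X_of_congruent_conjA
    (h22 : Kobayashi2003.thm22_etaSignedSelmerDual_finite_torsion)
    (h41 : Kobayashi2003.thm41_plusEtaCharIdeal_dvd)
    (h6273 : Kobayashi2003.thm62_63_73_etaColemanPoitouTate)
    (V : WeierstrassCurve ℚ) [V.IsElliptic] [V.IsGloballyMinimal] (C : VariableChange ℚ)
    (hp5 : 5 ≤ p) (hCV : C • W.quadraticTwist ((-1) ^ (p / 2) * p) = V)
    (hgood : V.HasGoodReductionAtPrime p) (hap : V.frobeniusTrace p = 0)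
    (hinf : ¬ Finite ↥(W.selmerGroupPInfty p))
    (hX : ∀ {N : ℕ} [NeZero N] {f : CuspForm (Gamma0 N) 2}, IsNewformOf V f →
      ∀ (ϖ : ℚ), (if Even (p / 2) then (ϖ : ℝ) * V.realPeriodRat = plusPeriod f
          else (ϖ : ℝ) * V.imaginaryPeriodRat = minusPeriod f) →
      ∀ (Lη : IwasawaAlgebra p), IsQuadraticBranchPlusLFunction f p ϖ Lη →
        Ideal.span {Lη} = Ideal.span {(PowerSeries.X : IwasawaAlgebra p)})
    (W' : WeierstrassCurve ℚ) [W'.IsElliptic]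
    (hcong : ∃ e : W.geomTorsion (p : ℤ) ≃+ W'.geomTorsion (p : ℤ),
      ∀ (σ : absoluteGaloisGroup ℚ) (P : W.geomTorsion (p : ℤ)), e (σ • P) = σ • e P)
    (hA' : ∀ (κ : ZpExtension ℚ p), κ.IsCyclotomic →
      ∃ (γ : absoluteGaloisGroup ℚ) (D : W'.FineSelmerDualData κ γ),
        Module.Finite ℤ_[p] (RestrictScalars ℤ_[p] (IwasawaAlgebra p) D.X)) :
    QuadraticBranchPlusEtaMainConjectureAt V p :=
  have hp2 : p ≠ 2 := by omega
  quadraticBranchPlusEtaMainConjectureAt_of_span_eq_span_X_of_conjA W p h22 h41 h6273 V C hp5 hCV hgood hap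
    hinf hX (conjA_of_torsionIso_of_conjA W p hp2 W' hcong hA')

end Anchor

end EtaFineRoad

end Summit.BirchSwinnertonDyer.BirchSwinnertonDyer.Theorems

end
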